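import Summits.QuantumAdvantage.AdviceFreeQNC0.BlockNormUniformProof
import Summits.QuantumAdvantage.AdviceFreeQNC0.TwistBoundStateLocal
import HarnessLib

/-!
# Cell qa-qnc0, `p = 3` — twist bounds SHARP IN THE RADIUS: exponent `(#supp γ − 4r − 1)/(2r+1)` (from `blockNormUniform3`)

With the uniform block norm `(2+√3)/4` (`BlockNormUniformProof.blockNormUniform3`, g23) the block-decay arguments of
`TwistBoundX3LocalProof` (g22, `r`-local letter rules) and `TwistBoundEval` (g23, evaluated / walk-window-local / state-aware strategies)
run with the `r`-INDEPENDENT per-block rate `ρ₀ = √((2+√3)/4) ≈ 0.966`: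

* `blockOpR_le_uniform` — the block hypothesis of `main_bound` / `main_boundU` with `ρ₀` for every `r`;
* **`twistBoundStateLocalSharp : TwistBoundStateLocalSharp`** — `‖Σ_u e₃(γ·x(u))[WIN_c(Y)(u)]‖ ≤ A·8^r·exp(−c₀(#supp γ − 4r − 1)/(2r+1))·2ⁿ`
  for state-aware window-local `Y` (`A = 9ρ₀⁻²`, `c₀ = −log ρ₀ > 0`), every `r, n, c`;
* **`twistBoundX3LocalSharp : TwistBoundX3LocalSharp`** — the same for `r`-local LETTER rules in the odd-class / `Rel` frame.

This replaces the `(2r+1)^{-3}` of `TwistBoundX3LocalQ` / `TwistBoundStateLocalQ` by `(2r+1)^{-1}` — the order p2 g36 (Corollary 36.U′) showed to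
be the truth (speaker lower bound `ln(9/4)/(2r+1)`).  WHAT THIS IS NOT: crux 22907 untouched; no separation.
-/

noncomputable section

namespace Summit.QuantumAdvantage.AdviceFreeQNC0

open Finset Literature.Computability.MetaComplexity Literature.Computability.QuantumComplexity
open Literature.Computability.QuantumComplexity.RingHLF

namespace BondTwist3

open TransferWalk ConstBells TwistedTransfer

/-- The uniform per-block rate `ρ₀ = √((2+√3)/4)`. -/
def rho0 : ℝ := Real.sqrt ((2 + Real.sqrt 3) / 4)

/-- `0 < ρ₀ < 1` and `ρ₀² = (2+√3)/4`. -/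
theorem rho0_facts : 0 < rho0 ∧ rho0 < 1 ∧ rho0 ^ 2 = (2 + Real.sqrt 3) / 4 := by
  have h3 : Real.sqrt 3 < 2 := by
    rw [show (2 : ℝ) = Real.sqrt 4 by rw [show (4 : ℝ) = 2 ^ 2 by norm_num, Real.sqrt_sq (by norm_num)]]
    exact Real.sqrt_lt_sqrt (by norm_num) (by norm_num)
  have h0 : 0 ≤ Real.sqrt 3 := Real.sqrt_nonneg _
  refine ⟨Real.sqrt_pos.2 (by positivity), ?_, Real.sq_sqrt (by positivity)⟩
  unfold rho0
  rw [show (1 : ℝ) = Real.sqrt 1 by simp]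
  exact Real.sqrt_lt_sqrt (by positivity) (by linarith)

/-- **The block hypothesis with the uniform rate**, for every radius. -/
theorem blockOpR_le_uniform (r : ℕ) :
    ∀ (ζ₀ : ℂ), ζ₀ ^ 3 = 1 → ζ₀ ≠ 1 → ∀ (ω : Fin (2 * r) → ℂ), (∀ j, ω j ^ 3 = 1) →
      ∀ (ε' : Fin (2 * r + 1) → RegState r → Bool → Bool) (g : RegState r → ℂ),
        rnsq (blockOpR ζ₀ ω ε' g) ≤ rho0 ^ 2 * rnsq g := by
  intro ζ₀ h3 h1 ω hω ε' g
  rw [rho0_facts.2.2]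
  exact blockNormUniform3 r ζ₀ h3 h1 ω (fun j => norm_eq_one_of_cube (hω j)) ε' g

/-- The rate step: `ρ₀^{cnt} ≤ exp(−c₀ (s − 4r − 1)/(2r+1))` once `(s − 4r) − 1 ≤ (2r+1)·cnt`, `c₀ = −log ρ₀`. -/
theorem rho0_pow_le {r cnt : ℕ} {s : ℝ} (h : (s - 4 * r) - 1 ≤ (2 * (r : ℝ) + 1) * cnt) :
    rho0 ^ cnt ≤ Real.exp (-(-Real.log rho0 * (s - 4 * r - 1) / (2 * (r : ℝ) + 1))) := by
  obtain ⟨hpos, hlt1, _⟩ := rho0_facts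
  have hlog : Real.log rho0 < 0 := Real.log_neg hpos hlt1
  have hR : (0 : ℝ) < 2 * (r : ℝ) + 1 := by positivity
  rw [← Real.exp_log (pow_pos hpos cnt), Real.exp_le_exp, Real.log_pow]
  have h1 : (s - 4 * r - 1) / (2 * (r : ℝ) + 1) ≤ cnt := by
    rw [div_le_iff₀ hR]; linarith
  have e : -(-Real.log rho0 * (s - 4 * r - 1) / (2 * (r : ℝ) + 1)) = (s - 4 * r - 1) / (2 * (r : ℝ) + 1) * Real.log rho0 := by
    ring
  rw [e]
  nlinarith

/-- The small-`n` step: `1 ≤ 9ρ₀⁻²·8^r·exp(−c₀(s − 4r − 1)/(2r+1))` when `s ≤ 4r + 3`. -/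
theorem one_le_sharp_const {r : ℕ} {s : ℝ} (hs : s ≤ 4 * r + 3) :
    (1 : ℝ) ≤ 9 * (rho0⁻¹) ^ 2 * 8 ^ r * Real.exp (-(-Real.log rho0 * (s - 4 * r - 1) / (2 * (r : ℝ) + 1))) := by
  obtain ⟨hpos, hlt1, _⟩ := rho0_facts
  have hlog : Real.log rho0 < 0 := Real.log_neg hpos hlt1
  have hR : (1 : ℝ) ≤ 2 * (r : ℝ) + 1 := by have : (0 : ℝ) ≤ r := Nat.cast_nonneg r; linarith
  -- the exponential is `≥ ρ₀²`
  have hexp : rho0 ^ 2 ≤ Real.exp (-(-Real.log rho0 * (s - 4 * r - 1) / (2 * (r : ℝ) + 1))) := by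
    rw [← Real.exp_log (pow_pos hpos 2), Real.exp_le_exp, Real.log_pow]
    have e : -(-Real.log rho0 * (s - 4 * r - 1) / (2 * (r : ℝ) + 1)) = ((s - 4 * r - 1) / (2 * (r : ℝ) + 1)) * Real.log rho0 := by
      ring
    rw [e]
    have h2 : (s - 4 * r - 1) / (2 * (r : ℝ) + 1) ≤ 2 := by
      rw [div_le_iff₀ (by linarith)]; nlinarith
    push_cast
    nlinarith
  have h8 : (1 : ℝ) ≤ 8 ^ r := one_le_pow₀ (by norm_num)
  have hρ2 : 0 < rho0 ^ 2 := by positivity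
  calc (1 : ℝ) = 1 * 1 * 1 := by ring
    _ ≤ 9 * (8 : ℝ) ^ r * ((rho0⁻¹) ^ 2 * rho0 ^ 2) := by
        rw [← mul_pow, inv_mul_cancel₀ hpos.ne', one_pow]; nlinarith
    _ ≤ 9 * (8 : ℝ) ^ r * ((rho0⁻¹) ^ 2 * Real.exp (-(-Real.log rho0 * (s - 4 * r - 1) / (2 * (r : ℝ) + 1)))) := by
        gcongr
    _ = 9 * (rho0⁻¹) ^ 2 * 8 ^ r * Real.exp (-(-Real.log rho0 * (s - 4 * r - 1) / (2 * (r : ℝ) + 1))) := by ring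

/-! ## Walk-window-local / state-aware strategies -/

/-- **`TwistBoundStateLocalSharp`**: exponent `(#supp γ − 4r − 1)/(2r+1)`. -/
def TwistBoundStateLocalSharp : Prop :=
  ∃ A c₀ : ℝ, 0 < c₀ ∧ ∀ (r n c : ℕ) (Y : Fin (n + 1) → (Fin n → Bool) → Bool), StateWindowLocal r Y →
    ∀ γ : Fin (n + 1) → ZMod 3,
      ‖∑ u : Fin n → Bool, (ZMod.stdAddChar (∑ i : Fin (n + 1), if xOfU u i then γ i else 0) : ℂ) *
          (if ringWinU c Y u = true then (1 : ℂ) else 0)‖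
        ≤ A * (8 : ℝ) ^ r *
            Real.exp (-(c₀ * (((univ.filter fun i : Fin (n + 1) => γ i ≠ 0).card : ℝ) - 4 * r - 1) / (2 * (r : ℝ) + 1))) *
          (2 : ℝ) ^ n

/-- **`twistBoundStateLocalSharp : TwistBoundStateLocalSharp` — PROVED** (`A = 9ρ₀⁻²`, `c₀ = −log ρ₀`). -/
theorem twistBoundStateLocalSharp : TwistBoundStateLocalSharp := by
  classical
  obtain ⟨hpos, hlt1, _⟩ := rho0_facts
  refine ⟨9 * (rho0⁻¹) ^ 2, -Real.log rho0, by have := Real.log_neg hpos hlt1; linarith, fun r n c Y hY γ => ?_⟩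
  obtain ⟨em, ef, hem, hf⟩ := eval_of_stateWindowLocal hY
  set w := (univ.filter fun i : Fin (n + 1) => γ i ≠ 0).card with hw
  have hwN : w ≤ n + 1 := (card_filter_le _ _).trans (by simp)
  by_cases hN : n < 4 * r + 3
  · refine (trivial_boundU c Y γ).trans ?_
    have hs : (w : ℝ) ≤ 4 * r + 3 := by
      have : w ≤ 4 * r + 3 := by omega
      exact_mod_cast this
    have h1 := one_le_sharp_const (r := r) hs
    have h2N : (0 : ℝ) < (2 : ℝ) ^ n := by positivity
    calc (2 : ℝ) ^ n = 1 * (2 : ℝ) ^ n := by ring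
      _ ≤ (9 * (rho0⁻¹) ^ 2 * 8 ^ r * Real.exp (-(-Real.log rho0 * ((w : ℝ) - 4 * r - 1) / (2 * (r : ℝ) + 1)))) * (2 : ℝ) ^ n :=
          mul_le_mul_of_nonneg_right h1 h2N.le
  have hn : 4 * r + 3 ≤ n := by omega
  refine (main_boundU hpos.le (blockOpR_le_uniform r) hem hf c γ hn).trans ?_
  set cb := cnt (bsOf r n γ) (2 * r + 1) 0 n with hc
  have hcnt : w - (4 * r + 1) ≤ (2 * r + 1) * cb := by
    have h1 := card_starts_le (bsOf r n γ) (show 0 < 2 * r + 1 by omega) n 0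
    rw [← hc] at h1
    have h2 := card_supp_le (r := r) γ
    omega
  have hc' : ((w : ℝ) - 4 * r) - 1 ≤ (2 * (r : ℝ) + 1) * cb := by
    by_cases hle : 4 * r + 1 ≤ w
    · have : (((w - (4 * r + 1) : ℕ)) : ℝ) ≤ (((2 * r + 1) * cb : ℕ) : ℝ) := by exact_mod_cast hcnt
      rw [Nat.cast_sub hle] at this
      push_cast at this
      linarith
    · have h0 : (0 : ℝ) ≤ (2 * (r : ℝ) + 1) * cb := by positivity
      have : (w : ℝ) < 4 * r + 1 := by exact_mod_cast (not_le.1 hle)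
      linarith
  have hρc := rho0_pow_le hc'
  have hK : (1 : ℝ) ≤ (rho0⁻¹) ^ 2 := one_le_pow₀ ((one_le_inv₀ hpos).2 hlt1.le)
  have h2N : (0 : ℝ) ≤ (2 : ℝ) ^ n := by positivity
  calc 9 * 8 ^ r * rho0 ^ cb * (2 : ℝ) ^ n
      ≤ 9 * 8 ^ r * Real.exp (-(-Real.log rho0 * ((w : ℝ) - 4 * r - 1) / (2 * (r : ℝ) + 1))) * (2 : ℝ) ^ n := by gcongr
    _ = (9 * 1 * 8 ^ r) * Real.exp (-(-Real.log rho0 * ((w : ℝ) - 4 * r - 1) / (2 * (r : ℝ) + 1))) * (2 : ℝ) ^ n := by ring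
    _ ≤ (9 * (rho0⁻¹) ^ 2 * 8 ^ r) * Real.exp (-(-Real.log rho0 * ((w : ℝ) - 4 * r - 1) / (2 * (r : ℝ) + 1))) * (2 : ℝ) ^ n := by
        gcongr

/-! ## Letter-local rules (the x-frame of `TwistBoundX3Local`) -/

/-- **`TwistBoundX3LocalSharp`**: the odd-class / `Rel` twisted sum of an `r`-local letter rule, exponent `(#supp γ − 4r − 1)/(2r+1)`. -/
def TwistBoundX3LocalSharp : Prop :=
  open scoped Classical in
  ∃ A c₀ : ℝ, 0 < c₀ ∧ ∀ (r N : ℕ) (t : Fin N → (Fin N → Bool) → Bool), IsLocalRule N r t →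
    ∀ γ : Fin N → ZMod 3,
      ‖∑ x : Fin N → Bool,
          (ZMod.stdAddChar (∑ i : Fin N, if x i then γ i else 0) : ℂ) *
            (if (OddZeros x ∧ RingHLF.Rel x (fun k => xor (tGuess x k) (t k x))) then (1 : ℂ) else 0)‖
        ≤ A * (8 : ℝ) ^ r *
            Real.exp (-(c₀ * (((univ.filter fun i : Fin N => γ i ≠ 0).card : ℝ) - 4 * r - 1) / (2 * (r : ℝ) + 1))) *
          (2 : ℝ) ^ N

open scoped Classical in
/-- **`twistBoundX3LocalSharp : TwistBoundX3LocalSharp` — PROVED** (`A = 9ρ₀⁻²`, `c₀ = −log ρ₀`). -/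
theorem twistBoundX3LocalSharp : TwistBoundX3LocalSharp := by
  classical
  obtain ⟨hpos, hlt1, _⟩ := rho0_facts
  refine ⟨9 * (rho0⁻¹) ^ 2, -Real.log rho0, by have := Real.log_neg hpos hlt1; linarith, fun r N t hloc γ => ?_⟩
  set w := (univ.filter fun i : Fin N => γ i ≠ 0).card with hw
  have hwN : w ≤ N := (card_filter_le _ _).trans (by simp)
  by_cases hN : N ≤ 4 * r + 3
  · refine (trivial_bound N t γ).trans ?_
    have hs : (w : ℝ) ≤ 4 * r + 3 := by exact_mod_cast (hwN.trans hN)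
    have h1 := one_le_sharp_const (r := r) hs
    have h2N : (0 : ℝ) < (2 : ℝ) ^ N := by positivity
    calc (2 : ℝ) ^ N = 1 * (2 : ℝ) ^ N := by ring
      _ ≤ (9 * (rho0⁻¹) ^ 2 * 8 ^ r * Real.exp (-(-Real.log rho0 * ((w : ℝ) - 4 * r - 1) / (2 * (r : ℝ) + 1)))) * (2 : ℝ) ^ N :=
          mul_le_mul_of_nonneg_right h1 h2N.le
  obtain ⟨n, rfl⟩ : ∃ n, N = n + 1 := ⟨N - 1, by omega⟩
  have hn : 4 * r + 3 ≤ n := by omega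
  refine (main_bound hpos.le (blockOpR_le_uniform r) hloc γ hn).trans ?_
  set cb := cnt (bsOf r n γ) (2 * r + 1) 0 n with hc
  have hcnt : w - (4 * r + 1) ≤ (2 * r + 1) * cb := by
    have h1 := card_starts_le (bsOf r n γ) (show 0 < 2 * r + 1 by omega) n 0
    rw [← hc] at h1
    have h2 := card_supp_le (r := r) γ
    omega
  have hc' : ((w : ℝ) - 4 * r) - 1 ≤ (2 * (r : ℝ) + 1) * cb := by
    by_cases hle : 4 * r + 1 ≤ w
    · have : (((w - (4 * r + 1) : ℕ)) : ℝ) ≤ (((2 * r + 1) * cb : ℕ) : ℝ) := by exact_mod_cast hcnt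
      rw [Nat.cast_sub hle] at this
      push_cast at this
      linarith
    · have h0 : (0 : ℝ) ≤ (2 * (r : ℝ) + 1) * cb := by positivity
      have : (w : ℝ) < 4 * r + 1 := by exact_mod_cast (not_le.1 hle)
      linarith
  have hρc := rho0_pow_le hc'
  have hK : (1 : ℝ) ≤ (rho0⁻¹) ^ 2 := one_le_pow₀ ((one_le_inv₀ hpos).2 hlt1.le)
  have h2n : (2 : ℝ) ^ n ≤ (2 : ℝ) ^ (n + 1) := pow_le_pow_right₀ (by norm_num) (by omega)
  calc 9 * 8 ^ r * rho0 ^ cb * (2 : ℝ) ^ n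
      ≤ 9 * 8 ^ r * Real.exp (-(-Real.log rho0 * ((w : ℝ) - 4 * r - 1) / (2 * (r : ℝ) + 1))) * (2 : ℝ) ^ (n + 1) := by gcongr
    _ = (9 * 1 * 8 ^ r) * Real.exp (-(-Real.log rho0 * ((w : ℝ) - 4 * r - 1) / (2 * (r : ℝ) + 1))) * (2 : ℝ) ^ (n + 1) := by ring
    _ ≤ (9 * (rho0⁻¹) ^ 2 * 8 ^ r) * Real.exp (-(-Real.log rho0 * ((w : ℝ) - 4 * r - 1) / (2 * (r : ℝ) + 1))) *
          (2 : ℝ) ^ (n + 1) := by gcongr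

end BondTwist3

end Summit.QuantumAdvantage.AdviceFreeQNC0

end
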